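import Mathlib
import Summits.ValiantsHypothesis.ValiantsHypothesis.Statement
import Summits.ValiantsHypothesis.ValiantsHypothesis.Theorems.SoloInformedSumsetGirth
import HarnessLib

/-!
# Soloist (informed) rung: the bilinear / determinantal girth bound (Cor. 7.18) in kernel form

Session s33 of the soloist programme `solo-ValiantsHypothesis-informed`.

The weakest certified-sufficient statement for `ValiantsHypothesis` on this line is the univariate
polynomial window bound `soloInformed_valiantsHypothesis_of_unipolyLogOrderBound`: sets `E ⊂ ℕ`
free of short `±`-relations (`SoloNatFree`) whose powers `t^e` lie in the span of the pairwise
products of `s` polynomials should have `|E| ≤ C s^γ`, `γ < 3/2`.  Its sparse-support case is the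
sumset girth bound (`SoloInformedSumsetGirth.lean`).  This file lands the PRODUCT-RANK-2 tool
(quadspan notes Theorem 7.17 / Corollary 7.18 (s11); the "dendrogram–bundle" proof of s32):

* `soloInformed_bilinearGirth` — let `u_i = (p i, q i)`, `i < L`, be NONZERO columns of
  polynomials over a field, and `E ⊂ ℕ` a set of exponents such that every `X^e`, `e ∈ E`, is a
  nonzero scalar multiple of some minor `det(u_i,u_j) = p_i q_j - p_j q_i`.  If `E` is
  `(K,h)`-free with `2k ≤ K`, `h ≥ 1`, then `|E| ≤ N + 86 k N^{1+1/k}`, `N = L(⌊log₂ L⌋ + 1)`: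
  the girth bound IN THE NUMBER OF VECTORS, up to one logarithm, for all degrees and anchors.

Proof (valuation at `0` only).  `μ_i` = order of the column `u_i`, `d(i,j)` = order of
`det(u_i,u_j)` (`⊤` if it vanishes).  CRAMER ULTRAMETRIC (`solo_bg_ultra`): from
`det(u_i,u_l) u_j = det(u_j,u_l) u_i + det(u_i,u_j) u_l` one gets
`d(i,l) + μ_j ≥ min (d(i,j) + μ_l, d(j,l) + μ_i)`, so the classes
`C_i(θ) = {x : d(i,x) ≥ θ + μ_i + μ_x}` at a fixed level partition the columns
(`solo_bg_cl_eq_of_mem`).  For `X^e ∝ det(u_i,u_j)` put `θ = e - μ_i - μ_j`: `C_i(θ+1)` and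
`C_j(θ+1)` are disjoint inside `C_i(θ) = C_j(θ)` (`solo_bg_split`); assign `e` to the endpoint `o`
whose `(θ+1)`-class is not the larger, so `2|C_o(θ+1)| ≤ |C_o(θ)|`.  For a fixed owner the levels
that occur have classes that at least halve (`solo_halving_chain`): at most `⌊log₂ L⌋` levels,
at most `L⌊log₂ L⌋` pairs `(o, θ)`.  Finally `e = (μ_o + θ) + μ_{other}`, so `E ⊆ Â + Â` with
`|Â| ≤ L(⌊log₂ L⌋ + 1)` and `soloInformed_sumsetGirth` (Bondy–Simonovits) finishes.

PATH TO THE SUMMIT.  If the realisation of `E` in `span{b_j b_k}` is determinantal from `L`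
columns with `L ≤ s · polylog(s)`, then at `K = ⌊log₂ s⌋ + 2` the bound is `s^{1+o(1)}`, inside
the hypothesis `hQ` of `soloInformed_valiantsHypothesis_of_unipolyLogOrderBound`.  What is NOT
bounded here is `L` in terms of `s = dim span{entries}`: the conversion `n → s` ("vector
proliferation", quadspan Remark 7.19) is the open core of the line; nothing here touches it.

References: Bondy–Simonovits, JCTB 16 (1974) 97–105 (through `SoloInformedSumsetGirth`); soloist
notes `paper/quadspan.md` 7.17–7.19, 2.54, `work/s32/s32.md` §4, `paper/sharpest.md` §9.11.
-/

namespace Summit.ValiantsHypothesis.ValiantsHypothesis.Theorems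

open Finset Polynomial
open scoped Pointwise

/-- `min (ord p) (ord q) ≤ ord (p + q)` for trailing degrees (orders of vanishing at `0`). -/
theorem solo_le_trailingDegree_add {R : Type*} [Semiring R] (p q : R[X]) :
    min p.trailingDegree q.trailingDegree ≤ (p + q).trailingDegree := by
  by_cases hpq : p + q = 0
  · rw [hpq, trailingDegree_zero]; exact le_top
  have h : (p + q).trailingCoeff ≠ 0 := mt trailingCoeff_eq_zero.mp hpq
  rw [trailingCoeff, coeff_add] at h
  rw [trailingDegree_eq_natTrailingDegree hpq]
  by_cases hp : p.coeff (p + q).natTrailingDegree = 0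
  · rw [hp, zero_add] at h
    exact (min_le_right _ _).trans (trailingDegree_le_of_ne_zero h)
  · exact (min_le_left _ _).trans (trailingDegree_le_of_ne_zero hp)

section Columns

variable {F : Type*} [Field F] {L : ℕ} (p q : Fin L → F[X])

/-- The `2 × 2` minor `det(u_i, u_j) = p_i q_j - p_j q_i` of the columns `u_i = (p_i, q_i)`. -/
noncomputable def soloBGdet (i j : Fin L) : F[X] := p i * q j - p j * q i

/-- The order at `0` of the column `u_i = (p_i, q_i)` (in `ℕ∞`; `⊤` iff the column vanishes). -/
noncomputable def soloBGmu (i : Fin L) : ℕ∞ := min (p i).trailingDegree (q i).trailingDegree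

/-- The order at `0` of a nonzero column, as a natural number. -/
noncomputable def soloBGm (i : Fin L) : ℕ := (soloBGmu p q i).toNat

/-- The order at `0` of the minor `det(u_i, u_j)` (in `ℕ∞`). -/
noncomputable def soloBGd (i j : Fin L) : ℕ∞ := (soloBGdet p q i j).trailingDegree

/-- `det(u_i, u_i) = 0` has order `⊤`. -/
theorem solo_bg_d_self (i : Fin L) : soloBGd p q i i = ⊤ := by
  have h : soloBGdet p q i i = 0 := by simp only [soloBGdet]; ring
  simp only [soloBGd, h, trailingDegree_zero]

/-- The order of a minor is symmetric in the two columns. -/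
theorem solo_bg_d_symm (i j : Fin L) : soloBGd p q j i = soloBGd p q i j := by
  have h : soloBGdet p q j i = -soloBGdet p q i j := by simp only [soloBGdet]; ring
  simp only [soloBGd, h, trailingDegree_neg]

/-- `μ_i + μ_j ≤ ord det(u_i, u_j)`. -/
theorem solo_bg_mu_add_le_d (i j : Fin L) :
    soloBGmu p q i + soloBGmu p q j ≤ soloBGd p q i j := by
  simp only [soloBGmu, soloBGd, soloBGdet]
  have h1 : min (p i).trailingDegree (q i).trailingDegree +
      min (p j).trailingDegree (q j).trailingDegree ≤ (p i * q j).trailingDegree :=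
    (add_le_add (min_le_left _ _) (min_le_right _ _)).trans le_trailingDegree_mul
  have h2 : min (p i).trailingDegree (q i).trailingDegree +
      min (p j).trailingDegree (q j).trailingDegree ≤ (-(p j * q i)).trailingDegree := by
    rw [trailingDegree_neg]
    calc min (p i).trailingDegree (q i).trailingDegree +
          min (p j).trailingDegree (q j).trailingDegree
        ≤ (q i).trailingDegree + (p j).trailingDegree :=
          add_le_add (min_le_right _ _) (min_le_left _ _)
      _ = (p j).trailingDegree + (q i).trailingDegree := add_comm _ _
      _ ≤ (p j * q i).trailingDegree := le_trailingDegree_mul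
  rw [sub_eq_add_neg]
  exact (le_min h1 h2).trans (solo_le_trailingDegree_add _ _)

/-- One coordinate of the CRAMER ULTRAMETRIC inequality, from the identity
`det(u_i,u_l) r_j = det(u_j,u_l) r_i + det(u_i,u_j) r_l` (valid for `r = p` and `r = q`). -/
theorem solo_bg_ultra_coord (i j l : Fin L) (r : Fin L → F[X])
    (hid : soloBGdet p q i l * r j = soloBGdet p q j l * r i + soloBGdet p q i j * r l) :
    min (soloBGd p q i j + (r l).trailingDegree) (soloBGd p q j l + (r i).trailingDegree)
      ≤ soloBGd p q i l + (r j).trailingDegree := by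
  simp only [soloBGd]
  have h : (soloBGdet p q i l).trailingDegree + (r j).trailingDegree =
      (soloBGdet p q j l * r i + soloBGdet p q i j * r l).trailingDegree := by
    rw [← trailingDegree_mul, hid]
  rw [h]
  refine le_trans ?_ (solo_le_trailingDegree_add _ _)
  exact le_min ((min_le_right _ _).trans le_trailingDegree_mul)
    ((min_le_left _ _).trans le_trailingDegree_mul)

/-- CRAMER ULTRAMETRIC: `min (d(i,j) + μ_l) (d(j,l) + μ_i) ≤ d(i,l) + μ_j`. -/
theorem solo_bg_ultra (i j l : Fin L) :
    min (soloBGd p q i j + soloBGmu p q l) (soloBGd p q j l + soloBGmu p q i)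
      ≤ soloBGd p q i l + soloBGmu p q j := by
  have A : ∀ r : Fin L → F[X],
      soloBGdet p q i l * r j = soloBGdet p q j l * r i + soloBGdet p q i j * r l →
      (∀ x, soloBGmu p q x ≤ (r x).trailingDegree) →
      min (soloBGd p q i j + soloBGmu p q l) (soloBGd p q j l + soloBGmu p q i)
        ≤ soloBGd p q i l + (r j).trailingDegree := by
    intro r hid hle
    refine le_trans ?_ (solo_bg_ultra_coord p q i j l r hid)
    exact min_le_min (add_le_add le_rfl (hle l)) (add_le_add le_rfl (hle i))
  have hp := A p (by simp only [soloBGdet]; ring) (fun x => by simp only [soloBGmu]; exact min_le_left _ _)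
  have hq := A q (by simp only [soloBGdet]; ring) (fun x => by simp only [soloBGmu]; exact min_le_right _ _)
  calc min (soloBGd p q i j + soloBGmu p q l) (soloBGd p q j l + soloBGmu p q i)
      ≤ min (soloBGd p q i l + (p j).trailingDegree) (soloBGd p q i l + (q j).trailingDegree) :=
        le_min hp hq
    _ = soloBGd p q i l + soloBGmu p q j := by rw [soloBGmu]; exact min_add_add_left _ _ _

variable {p q}

/-- A nonzero column has finite order. -/
theorem solo_bg_mu_ne_top {i : Fin L} (hcol : p i ≠ 0 ∨ q i ≠ 0) : soloBGmu p q i ≠ ⊤ := by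
  simp only [soloBGmu]
  rcases hcol with h | h
  · exact ne_top_of_le_ne_top (mt trailingDegree_eq_top.mp h) (min_le_left _ _)
  · exact ne_top_of_le_ne_top (mt trailingDegree_eq_top.mp h) (min_le_right _ _)

/-- For a nonzero column the natural-number order agrees with the `ℕ∞` order. -/
theorem solo_bg_m_coe {i : Fin L} (hcol : p i ≠ 0 ∨ q i ≠ 0) :
    ((soloBGm p q i : ℕ) : ℕ∞) = soloBGmu p q i := by
  simp only [soloBGm]
  exact ENat.coe_toNat (solo_bg_mu_ne_top hcol)

/-- The class of `i` at level `θ`: all columns `x` with `ord det(u_i,u_x) ≥ θ + μ_i + μ_x`. -/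
noncomputable def soloBGcl (p q : Fin L → F[X]) (i : Fin L) (θ : ℕ) : Finset (Fin L) :=
  univ.filter fun x => ((θ + soloBGm p q i + soloBGm p q x : ℕ) : ℕ∞) ≤ soloBGd p q i x

/-- Membership in a class, unfolded. -/
theorem solo_bg_mem_cl {i x : Fin L} {θ : ℕ} : x ∈ soloBGcl p q i θ ↔
    ((θ + soloBGm p q i + soloBGm p q x : ℕ) : ℕ∞) ≤ soloBGd p q i x := by
  simp [soloBGcl]

/-- Every column lies in all of its own classes. -/
theorem solo_bg_self_mem_cl (i : Fin L) (θ : ℕ) : i ∈ soloBGcl p q i θ := by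
  rw [solo_bg_mem_cl, solo_bg_d_self]; exact le_top

/-- Class membership is symmetric. -/
theorem solo_bg_mem_cl_comm {i x : Fin L} {θ : ℕ} :
    x ∈ soloBGcl p q i θ ↔ i ∈ soloBGcl p q x θ := by
  have h : θ + soloBGm p q x + soloBGm p q i = θ + soloBGm p q i + soloBGm p q x := by ring
  rw [solo_bg_mem_cl, solo_bg_mem_cl, solo_bg_d_symm p q x i, h]

/-- Classes shrink as the level grows. -/
theorem solo_bg_cl_antitone (i : Fin L) {θ θ' : ℕ} (h : θ ≤ θ') :
    soloBGcl p q i θ' ⊆ soloBGcl p q i θ := by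
  intro x hx
  rw [solo_bg_mem_cl] at hx ⊢
  refine le_trans ?_ hx
  exact_mod_cast (by omega : θ + soloBGm p q i + soloBGm p q x ≤ θ' + soloBGm p q i + soloBGm p q x)

/-- Transitivity of the classes (the ultrametric inequality at work). -/
theorem solo_bg_mem_cl_trans (hcol : ∀ i, p i ≠ 0 ∨ q i ≠ 0) {i x y : Fin L} {θ : ℕ}
    (hx : x ∈ soloBGcl p q i θ) (hy : y ∈ soloBGcl p q x θ) : y ∈ soloBGcl p q i θ := by
  rw [solo_bg_mem_cl] at hx hy ⊢
  have hu := solo_bg_ultra p q i x y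
  rw [← solo_bg_m_coe (hcol y), ← solo_bg_m_coe (hcol i), ← solo_bg_m_coe (hcol x)] at hu
  have e1 : ((θ + soloBGm p q i + soloBGm p q x + soloBGm p q y : ℕ) : ℕ∞) =
      ((θ + soloBGm p q i + soloBGm p q x : ℕ) : ℕ∞) + (soloBGm p q y : ℕ∞) := by
    push_cast; ring
  have e2 : ((θ + soloBGm p q i + soloBGm p q x + soloBGm p q y : ℕ) : ℕ∞) =
      ((θ + soloBGm p q x + soloBGm p q y : ℕ) : ℕ∞) + (soloBGm p q i : ℕ∞) := by
    push_cast; ring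
  have e4 : ((θ + soloBGm p q i + soloBGm p q y : ℕ) : ℕ∞) + (soloBGm p q x : ℕ∞) =
      ((θ + soloBGm p q i + soloBGm p q x + soloBGm p q y : ℕ) : ℕ∞) := by
    push_cast; ring
  have h1 : ((θ + soloBGm p q i + soloBGm p q x + soloBGm p q y : ℕ) : ℕ∞)
      ≤ soloBGd p q i x + (soloBGm p q y : ℕ∞) := by rw [e1]; exact add_le_add hx le_rfl
  have h2 : ((θ + soloBGm p q i + soloBGm p q x + soloBGm p q y : ℕ) : ℕ∞)
      ≤ soloBGd p q x y + (soloBGm p q i : ℕ∞) := by rw [e2]; exact add_le_add hy le_rfl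
  have h3 := (le_min h1 h2).trans hu
  rw [← e4] at h3
  exact (ENat.add_le_add_iff_right (ENat.coe_ne_top _)).mp h3

/-- If `x ∈ C_i(θ)` then `C_x(θ) = C_i(θ)`: the classes at a fixed level partition the columns. -/
theorem solo_bg_cl_eq_of_mem (hcol : ∀ i, p i ≠ 0 ∨ q i ≠ 0) {i x : Fin L} {θ : ℕ}
    (hx : x ∈ soloBGcl p q i θ) : soloBGcl p q x θ = soloBGcl p q i θ := by
  ext y
  exact ⟨fun hy => solo_bg_mem_cl_trans hcol hx hy,
    fun hy => solo_bg_mem_cl_trans hcol (solo_bg_mem_cl_comm.mp hx) hy⟩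

/-- A class has at most `L` members. -/
theorem solo_bg_card_cl_le (i : Fin L) (θ : ℕ) : (soloBGcl p q i θ).card ≤ L := by
  calc (soloBGcl p q i θ).card ≤ (univ : Finset (Fin L)).card := card_le_univ _
    _ = L := by rw [card_univ, Fintype.card_fin]

/-- The splitting step: if `ord det(u_i,u_j) = θ + μ_i + μ_j` exactly, then `C_i(θ+1)` and
`C_j(θ+1)` are disjoint subsets of `C_i(θ) = C_j(θ)`. -/
theorem solo_bg_split (hcol : ∀ i, p i ≠ 0 ∨ q i ≠ 0) {i j : Fin L} {θ : ℕ}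
    (hd : soloBGd p q i j = ((θ + soloBGm p q i + soloBGm p q j : ℕ) : ℕ∞)) :
    (soloBGcl p q i (θ + 1)).card + (soloBGcl p q j (θ + 1)).card ≤ (soloBGcl p q i θ).card ∧
      soloBGcl p q j θ = soloBGcl p q i θ := by
  have hj : j ∈ soloBGcl p q i θ := by rw [solo_bg_mem_cl, hd]
  have hjθ : soloBGcl p q j θ = soloBGcl p q i θ := solo_bg_cl_eq_of_mem hcol hj
  refine ⟨?_, hjθ⟩
  have hj' : j ∉ soloBGcl p q i (θ + 1) := by
    rw [solo_bg_mem_cl, hd, Nat.cast_le]; omega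
  have hdisj : Disjoint (soloBGcl p q i (θ + 1)) (soloBGcl p q j (θ + 1)) := by
    rw [Finset.disjoint_left]
    intro y hyi hyj
    have h1 : soloBGcl p q y (θ + 1) = soloBGcl p q i (θ + 1) := solo_bg_cl_eq_of_mem hcol hyi
    have h2 : soloBGcl p q y (θ + 1) = soloBGcl p q j (θ + 1) := solo_bg_cl_eq_of_mem hcol hyj
    apply hj'
    rw [← h1, h2]
    exact solo_bg_self_mem_cl j (θ + 1)
  rw [← card_union_of_disjoint hdisj]
  apply card_le_card
  apply union_subset
  · exact solo_bg_cl_antitone i (Nat.le_succ θ)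
  · rw [← hjθ]; exact solo_bg_cl_antitone j (Nat.le_succ θ)

end Columns

/-- HALVING CHAIN: if `f ≥ 1` on `S ⊂ ℕ`, `2 f θ ≤ L` on `S`, and `2 f θ' ≤ f θ` whenever
`θ < θ'` in `S`, then `2^|S| ≤ L`. -/
theorem solo_halving_chain (S : Finset ℕ) (f : ℕ → ℕ) :
    ∀ L : ℕ, 1 ≤ L → (∀ θ ∈ S, 1 ≤ f θ) → (∀ θ ∈ S, 2 * f θ ≤ L) →
      (∀ θ ∈ S, ∀ θ' ∈ S, θ < θ' → 2 * f θ' ≤ f θ) → 2 ^ S.card ≤ L := by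
  induction S using Finset.induction_on_min with
  | empty => intro L hL _ _ _; simpa using hL
  | insert a s hlt ih =>
    intro L hL h1 h2 h3
    have ha : a ∉ s := fun h => lt_irrefl a (hlt a h)
    have hmem : a ∈ insert a s := mem_insert_self a s
    have ih' : 2 ^ s.card ≤ f a := by
      refine ih (f a) (h1 a hmem) (fun θ hθ => h1 θ (mem_insert_of_mem hθ)) ?_ ?_
      · intro θ hθ
        exact h3 a hmem θ (mem_insert_of_mem hθ) (hlt θ hθ)
      · intro θ hθ θ' hθ' hθθ'
        exact h3 θ (mem_insert_of_mem hθ) θ' (mem_insert_of_mem hθ') hθθ'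
    rw [card_insert_of_notMem ha, pow_succ]
    calc 2 ^ s.card * 2 ≤ f a * 2 := Nat.mul_le_mul_right 2 ih'
      _ = 2 * f a := by ring
      _ ≤ L := h2 a hmem

/-- **Bilinear / determinantal girth bound** (quadspan Corollary 7.18; kernel form, s33).
Let `u_i = (p i, q i)`, `i < L`, be nonzero columns of polynomials over a field `F`, and let
`E ⊂ ℕ` be a set of exponents such that every `X^e`, `e ∈ E`, is a nonzero scalar multiple of a
`2 × 2` minor `p_i q_j - p_j q_i`.  If `E` admits no nontrivial integer relation of support `≤ K`
and height `≤ h` (`SoloNatFree K h E`), `2k ≤ K`, `k ≥ 1`, `h ≥ 1`, then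
`|E| ≤ N + 86 k N^{1 + 1/k}` with `N = L (⌊log₂ L⌋ + 1)` — the girth bound in the number `L` of
vectors up to one logarithm, with no hypothesis on degrees, anchors or shifts.  (The OPEN
statement of the line bounds `|E|` by the dimension `s` of the span of the entries instead.) -/
theorem soloInformed_bilinearGirth {F : Type*} [Field F] {L K h k : ℕ}
    (hk : 1 ≤ k) (hK : 2 * k ≤ K) (hh : 1 ≤ h)
    (p q : Fin L → F[X]) (hcol : ∀ i, p i ≠ 0 ∨ q i ≠ 0) (E : Finset ℕ)
    (hE : ∀ e ∈ E, ∃ i j : Fin L, ∃ c : F, c ≠ 0 ∧ p i * q j - p j * q i = C c * X ^ e)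
    (hfree : SoloNatFree K h E) :
    (E.card : ℝ) ≤ (L * (Nat.log 2 L + 1) : ℕ) +
      86 * k * ((L * (Nat.log 2 L + 1) : ℕ) : ℝ) ^ (1 + 1 / (k : ℝ)) := by
  classical
  rcases Nat.eq_zero_or_pos L with hL | hL
  · subst hL
    have hE0 : E = ∅ := by
      rw [← subset_empty]
      intro e he
      obtain ⟨i, -, -, -, -⟩ := hE e he
      exact i.elim0
    subst hE0
    simp only [card_empty, Nat.cast_zero]
    positivity
  haveI : Inhabited (Fin L) := ⟨⟨0, hL⟩⟩
  choose! wi wj wc hwc hdet using hE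
  have hd : ∀ e ∈ E, soloBGd p q (wi e) (wj e) = (e : ℕ∞) := by
    intro e he
    simp only [soloBGd, soloBGdet, hdet e he]
    exact trailingDegree_C_mul_X_pow e (hwc e he)
  have hle : ∀ e ∈ E, soloBGm p q (wi e) + soloBGm p q (wj e) ≤ e := by
    intro e he
    have h := solo_bg_mu_add_le_d p q (wi e) (wj e)
    rw [hd e he, ← solo_bg_m_coe (hcol (wi e)), ← solo_bg_m_coe (hcol (wj e))] at h
    exact_mod_cast h
  set θf : ℕ → ℕ := fun e => e - (soloBGm p q (wi e) + soloBGm p q (wj e)) with hθf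
  have hθe : ∀ e ∈ E, e = θf e + soloBGm p q (wi e) + soloBGm p q (wj e) := by
    intro e he; have := hle e he; simp only [hθf]; omega
  have hdθ : ∀ e ∈ E, soloBGd p q (wi e) (wj e) =
      ((θf e + soloBGm p q (wi e) + soloBGm p q (wj e) : ℕ) : ℕ∞) := by
    intro e he; rw [hd e he]; exact_mod_cast hθe e he
  set own : ℕ → Fin L := fun e =>
    if (soloBGcl p q (wi e) (θf e + 1)).card ≤ (soloBGcl p q (wj e) (θf e + 1)).card
    then wi e else wj e with hown
  set oth : ℕ → Fin L := fun e =>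
    if (soloBGcl p q (wi e) (θf e + 1)).card ≤ (soloBGcl p q (wj e) (θf e + 1)).card
    then wj e else wi e with hoth
  have hsum : ∀ e ∈ E, e = θf e + soloBGm p q (own e) + soloBGm p q (oth e) := by
    intro e he
    have := hθe e he
    simp only [hown, hoth]
    split_ifs with hc
    · exact this
    · omega
  have hhalf : ∀ e ∈ E,
      2 * (soloBGcl p q (own e) (θf e + 1)).card ≤ (soloBGcl p q (own e) (θf e)).card := by
    intro e he
    obtain ⟨hsplit, heq⟩ := solo_bg_split hcol (hdθ e he)
    simp only [hown]
    split_ifs with hc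
    · omega
    · rw [heq]; omega
  set S : Fin L → Finset ℕ := fun i => (E.filter fun e => own e = i).image θf with hS
  have hScard : ∀ i, (S i).card ≤ Nat.log 2 L := by
    intro i
    apply Nat.le_log_of_pow_le one_lt_two
    refine solo_halving_chain (S i) (fun θ => (soloBGcl p q i (θ + 1)).card) L hL ?_ ?_ ?_
    · intro θ _
      exact Finset.card_pos.mpr ⟨i, solo_bg_self_mem_cl i (θ + 1)⟩
    · intro θ hθ
      simp only [hS, mem_image, mem_filter] at hθ
      obtain ⟨e, ⟨he, hoe⟩, rfl⟩ := hθ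
      have h1 := hhalf e he
      rw [hoe] at h1
      exact h1.trans (solo_bg_card_cl_le _ _)
    · intro θ hθ θ' hθ' hlt
      simp only [hS, mem_image, mem_filter] at hθ'
      obtain ⟨e', ⟨he', hoe'⟩, rfl⟩ := hθ'
      have h1 := hhalf e' he'
      rw [hoe'] at h1
      exact h1.trans (card_le_card (solo_bg_cl_antitone i (by omega)))
  set Bun : Finset (Fin L × ℕ) := E.image fun e => (own e, θf e) with hBun
  have hBun_card : Bun.card ≤ L * Nat.log 2 L := by
    have hsub : Bun ⊆ (univ : Finset (Fin L)).biUnion fun i => (S i).image (Prod.mk i) := by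
      intro b hb
      simp only [hBun, mem_image] at hb
      obtain ⟨e, he, rfl⟩ := hb
      rw [mem_biUnion]
      refine ⟨own e, mem_univ _, ?_⟩
      rw [mem_image]
      refine ⟨θf e, ?_, rfl⟩
      simp only [hS, mem_image, mem_filter]
      exact ⟨e, ⟨he, rfl⟩, rfl⟩
    calc Bun.card ≤ ((univ : Finset (Fin L)).biUnion fun i => (S i).image (Prod.mk i)).card :=
          card_le_card hsub
      _ ≤ ∑ i : Fin L, ((S i).image (Prod.mk i)).card := card_biUnion_le
      _ ≤ ∑ i : Fin L, Nat.log 2 L :=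
          sum_le_sum fun i _ => card_image_le.trans (hScard i)
      _ = L * Nat.log 2 L := by simp
  set A : Finset ℕ := Bun.image (fun b => soloBGm p q b.1 + b.2) ∪
    (univ : Finset (Fin L)).image (soloBGm p q) with hA
  have hA_card : A.card ≤ L * (Nat.log 2 L + 1) := by
    calc A.card ≤ (Bun.image (fun b => soloBGm p q b.1 + b.2)).card +
          ((univ : Finset (Fin L)).image (soloBGm p q)).card := card_union_le _ _
      _ ≤ Bun.card + (univ : Finset (Fin L)).card := add_le_add card_image_le card_image_le
      _ ≤ L * Nat.log 2 L + L := by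
          rw [card_univ, Fintype.card_fin]; exact add_le_add hBun_card le_rfl
      _ = L * (Nat.log 2 L + 1) := by ring
  have hEA : E ⊆ A + A := by
    intro e he
    rw [Finset.mem_add]
    refine ⟨soloBGm p q (own e) + θf e, ?_, soloBGm p q (oth e), ?_, ?_⟩
    · rw [hA, mem_union]; left
      rw [mem_image]
      exact ⟨(own e, θf e), by rw [hBun, mem_image]; exact ⟨e, he, rfl⟩, rfl⟩
    · rw [hA, mem_union]; right
      exact mem_image_of_mem _ (mem_univ _)
    · have := hsum e he; omega
  have hgirth := soloInformed_sumsetGirth hk hK hh A E hEA hfree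
  have hAc : (A.card : ℝ) ≤ ((L * (Nat.log 2 L + 1) : ℕ) : ℝ) := by exact_mod_cast hA_card
  have hpow : (A.card : ℝ) ^ (1 + 1 / (k : ℝ)) ≤
      ((L * (Nat.log 2 L + 1) : ℕ) : ℝ) ^ (1 + 1 / (k : ℝ)) :=
    Real.rpow_le_rpow (by positivity) hAc (by positivity)
  have hk0 : (0 : ℝ) ≤ 86 * k := by positivity
  linarith [mul_le_mul_of_nonneg_left hpow hk0]

end Summit.ValiantsHypothesis.ValiantsHypothesis.Theorems
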